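import Summits.ValiantsHypothesis.ValiantsHypothesis.Theorems.SoloBlindPlusLadderTerm

/-!
# The `+`-ladder above the permanent: the sharp mass bound `min(2^{⌈n/3⌉}, 1+M) ≤ 8 s (n+1)²`

`SoloBlindPlusLadder.lean` bounds the monotone complexity of `g := F_{n,n} + M · per_n` by
`min(2^{⌈n/3⌉}, √(1+M)) ≤ 8 s (n+1)²` with a Cauchy–Schwarz step.  Here the square root is removed:

  every monotone fan-in-two circuit over `ℝ≥0` computing `F_{n,n} + M · per_n` (`n ≥ 3`) has size
  `s` with `min(2^{⌈n/3⌉}, 1 + M) ≤ 8 s (n+1)²`   (`soloBlind_plusLadder_sharp`).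

The new step is a rank-one observation on the image classes of one ordered product `a b`
(`a` on rows `A`, `|A| = k`, `b` on `Aᶜ`, `a b ≤ g`): with `u_S := ∑_{Im τ = S} a(x_τ)`,
`v_S := ∑_{Im θ = Sᶜ} b(x_θ)`, `p_S := u_S v_S`, one has `p_S ≤ Z := k!(n-k)!(1+M)` and, for
`S ≠ S'`, `u_S v_{S'} ≤ z := k!(n-k)!` (every such pair glues to a NON-bijection, where `g` has
coefficient `1`), hence `p_S p_{S'} = (u_S v_{S'})(u_{S'} v_S) ≤ z²`: AT MOST ONE CLASS IS HEAVIER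
THAN `z`.  So `mass(a b) = ∑_S p_S ≤ Z + z·C(n,k) = k!(n-k)!(1+M) + n!` (`mass_term_le_sharp`), and
summing over the `T ≤ 4 s (n+1)²` terms of the structure theorem, `n!(1+M) ≤ T (n!(1+M)/2^{⌈n/3⌉} + n!)`.

This is where coefficient mass stops for good: `g ≤ (1+M) · F_{n,n}` coefficientwise and `F_{n,n}`
is itself ONE balanced ordered product, so every argument that is a nonnegative linear functional
on coefficients, feasible (`≤ 1`) on dominated products, certifies at most `1 + M` products; the
bound above attains that ceiling up to the factor `2^{⌈n/3⌉}/(2^{⌈n/3⌉} + 1 + M)`.  The open content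
of the ladder (`M ≤ n^{O(1)}`, ending in `VP ≠ VNP` as `M → 0⁺`) therefore needs an invariant that
is not a coefficient valuation.

References: M. Jerrum, M. Snir, J. ACM 29 (1982) (`M = ∞`); P. Hrubeš, comput. complexity 29
(2020), Thm 1 and the remark on coefficient-continuous bounds; structure theorem as in
Chattopadhyay–Datta–Ghosal–Mukhopadhyay (arXiv:2109.06941) §2, in the tree as
`ArithCircuit.exists_balanced_decomposition`.
-/

noncomputable section

open scoped NNReal Nat Classical
open MvPolynomial Finset Literature.Computability.AlgebraicComplexity

namespace Summit.ValiantsHypothesis.ValiantsHypothesis.Theorems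

namespace PlusLadder

variable {n : ℕ}

section Term

variable {A : Finset (Fin n)} {a b : MvPolynomial (Fin n × Fin n) ℝ≥0} {M : ℝ≥0}

/-- Off-diagonal class products are light: for `S ≠ S'`, `u_S · v_{S'} ≤ k!(n-k)!`, because every
pair (Alice injective with image `S`, Bob injective with image `S'ᶜ`) glues to a non-bijection,
where `F + M per` has coefficient `1`. -/
theorem cls_cross_le (ha : IsOrdered A a) (hb : IsOrdered Aᶜ b)
    (hle : ∀ m, coeff m (a * b) ≤ coeff m (ladder n M)) {S S' : Finset (Fin n)} (hne : S ≠ S') :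
    clsA A a S * clsB A b S' ≤ (A.card ! * (n - A.card) ! : ℝ) := by
  have hw : ∀ τ ∈ (injA A).filter (fun τ => univ.image τ = S),
      ∀ θ ∈ (injB A).filter (fun θ => (univ.image θ)ᶜ = S'), wA A a τ * wB A b θ ≤ 1 := by
    intro τ hτ θ hθ
    simp only [mem_filter, injA, injB, mem_univ, true_and] at hτ hθ
    have hnb : ¬ Function.Bijective ((splitEquiv A).symm (τ, θ)) := fun hb' => by
      have h3 := ((bijective_glue_iff A τ θ).1 hb').2.2
      exact hne (hτ.2.symm.trans (h3.symm.trans hθ.2))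
    rw [wA_mul_wB ha hb]
    exact_mod_cast (hle _).trans (coeff_monoMap_ladder_of_not_bijective M hnb).le
  have hI : (((injA A).filter fun τ => univ.image τ = S).card : ℝ) ≤ A.card ! := by
    exact_mod_cast card_filter_injective_image_le A S
  have hJ : (((injB A).filter fun θ => (univ.image θ)ᶜ = S').card : ℝ) ≤ (n - A.card) ! := by
    have h := card_filter_injective_image_le Aᶜ S'ᶜ
    rw [card_compl, Fintype.card_fin] at h
    have hset : ((injB A).filter fun θ => (univ.image θ)ᶜ = S') =
        (injB A).filter fun θ => univ.image θ = S'ᶜ :=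
      Finset.filter_congr fun θ _ =>
        ⟨fun h1 => by rw [← h1, compl_compl], fun h1 => by rw [h1, compl_compl]⟩
    rw [hset]
    exact_mod_cast h
  calc clsA A a S * clsB A b S'
      = ∑ τ ∈ (injA A).filter (fun τ => univ.image τ = S),
          ∑ θ ∈ (injB A).filter (fun θ => (univ.image θ)ᶜ = S'), wA A a τ * wB A b θ := by
        rw [clsA, clsB, Finset.sum_mul_sum]
    _ ≤ ∑ τ ∈ (injA A).filter (fun τ => univ.image τ = S),
          ∑ θ ∈ (injB A).filter (fun θ => (univ.image θ)ᶜ = S'), (1 : ℝ) :=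
        sum_le_sum fun τ hτ => sum_le_sum fun θ hθ => hw τ hτ θ hθ
    _ = ((injA A).filter fun τ => univ.image τ = S).card *
          ((((injB A).filter fun θ => (univ.image θ)ᶜ = S').card) * (1 : ℝ)) := by
        rw [sum_const, sum_const, nsmul_eq_mul, nsmul_eq_mul]
    _ ≤ A.card ! * ((n - A.card) ! * (1 : ℝ)) := by gcongr
    _ = _ := by ring

/-- Classes of the wrong size are empty: `u_S = 0` unless `|S| = |A|`. -/
theorem clsA_eq_zero_of_card_ne {S : Finset (Fin n)} (h : S.card ≠ A.card) : clsA A a S = 0 := by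
  unfold clsA
  refine Finset.sum_eq_zero fun τ hτ => ?_
  exfalso
  simp only [mem_filter, injA, mem_univ, true_and] at hτ
  apply h
  rw [← hτ.2, card_image_of_injective _ hτ.1, card_univ, Fintype.card_coe]

/-- **Sharp per-term estimate.** For an ordered product `a b ≤ F + M per` with `|A| = k`:
`mass(a b) ≤ k!(n-k)!(1+M) + n!` — at most one image class is heavier than `k!(n-k)!`. -/
theorem mass_term_le_sharp (ha : IsOrdered A a) (hb : IsOrdered Aᶜ b)
    (hle : ∀ m, coeff m (a * b) ≤ coeff m (ladder n M)) :
    mass (a * b) ≤ (A.card ! * (n - A.card) ! : ℝ) * (1 + M) + n ! := by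
  set k := A.card with hk
  set z : ℝ := (k ! * (n - k) ! : ℝ) with hz
  have hz0 : 0 ≤ z := by positivity
  have hkn : k ≤ n := by
    rw [hk]; exact (card_le_univ A).trans (by rw [Fintype.card_fin])
  -- the class products
  have p0 : ∀ S, 0 ≤ clsA A a S * clsB A b S := fun S => mul_nonneg (clsA_nonneg S) (clsB_nonneg S)
  have pZ : ∀ S, clsA A a S * clsB A b S ≤ z * (1 + M) := fun S => cls_mul_le ha hb hle S
  have pcross : ∀ S S', S ≠ S' →
      (clsA A a S * clsB A b S) * (clsA A a S' * clsB A b S') ≤ z * z := by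
    intro S S' hne
    have h1 : clsA A a S * clsB A b S' ≤ z := cls_cross_le ha hb hle hne
    have h2 : clsA A a S' * clsB A b S ≤ z := cls_cross_le ha hb hle hne.symm
    calc (clsA A a S * clsB A b S) * (clsA A a S' * clsB A b S')
        = (clsA A a S * clsB A b S') * (clsA A a S' * clsB A b S) := by ring
      _ ≤ z * z := mul_le_mul h1 h2 (mul_nonneg (clsA_nonneg _) (clsB_nonneg _)) hz0
  have pzero : ∀ S : Finset (Fin n), S.card ≠ k → clsA A a S * clsB A b S = 0 := fun S hS => by
    rw [clsA_eq_zero_of_card_ne hS, zero_mul]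
  -- a heaviest class; all others are light
  obtain ⟨S₀, -, hS₀⟩ := Finset.exists_max_image (univ : Finset (Finset (Fin n)))
    (fun S => clsA A a S * clsB A b S) ⟨∅, mem_univ _⟩
  have ple : ∀ S, S ≠ S₀ → clsA A a S * clsB A b S ≤ z := by
    intro S hne
    have h' : (clsA A a S * clsB A b S) * (clsA A a S * clsB A b S) ≤ z * z :=
      (mul_le_mul_of_nonneg_left (hS₀ S (mem_univ _)) (p0 S)).trans (pcross S S₀ hne)
    calc clsA A a S * clsB A b S
        = Real.sqrt ((clsA A a S * clsB A b S) * (clsA A a S * clsB A b S)) :=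
          (Real.sqrt_mul_self (p0 S)).symm
      _ ≤ Real.sqrt (z * z) := Real.sqrt_le_sqrt h'
      _ = z := Real.sqrt_mul_self hz0
  have hbound : ∀ S : Finset (Fin n), clsA A a S * clsB A b S ≤
      (if S = S₀ then z * (1 + M) else 0) + (if S.card = k then z else 0) := by
    intro S
    have hz' : 0 ≤ (if S.card = k then z else 0) := by split_ifs <;> [exact hz0; exact le_rfl]
    by_cases h1 : S = S₀
    · rw [if_pos h1]
      have := pZ S
      linarith
    · rw [if_neg h1, zero_add]
      by_cases h2 : S.card = k
      · rw [if_pos h2]; exact ple S h1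
      · rw [if_neg h2]; exact (pzero S h2).le
  -- counting the classes of size k
  have hcount : ∑ S : Finset (Fin n), (if S.card = k then z else 0) = n ! := by
    rw [← Finset.sum_filter, sum_const, nsmul_eq_mul]
    have hf : (univ.filter fun S : Finset (Fin n) => S.card = k) = univ.powersetCard k := by
      ext S; simp [Finset.mem_powersetCard]
    rw [hf, Finset.card_powersetCard, Finset.card_univ, Fintype.card_fin, hz]
    have h := Nat.choose_mul_factorial_mul_factorial hkn
    have h2 : n.choose k * (k ! * (n - k) !) = Nat.factorial n := by rw [← h]; ring
    have h' : ((n.choose k : ℕ) : ℝ) * ((k ! : ℝ) * (n - k) !) = n ! := by exact_mod_cast h2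
    exact h'
  calc mass (a * b) = ∑ S, clsA A a S * clsB A b S := mass_mul_eq_sum_cls ha hb
    _ ≤ ∑ S : Finset (Fin n),
          ((if S = S₀ then z * (1 + M) else 0) + (if S.card = k then z else 0)) :=
        sum_le_sum fun S _ => hbound S
    _ = z * (1 + M) + n ! := by
        rw [sum_add_distrib, hcount, Finset.sum_ite_eq' univ S₀, if_pos (mem_univ _)]

end Term

/-! ### The sharp lower bound -/

/-- **Theorem A′.**  Every monotone fan-in-two circuit computing `F_{n,n} + M · per_n` (`n ≥ 3`)
has size `s` with `2^{⌈n/3⌉} (1+M) ≤ 4 s (n+1)² (1 + M + 2^{⌈n/3⌉})`. -/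
theorem monotone_size_lower_bound_sharp (hn : 3 ≤ n) (M : ℝ≥0)
    (P : ArithCircuit ℝ≥0 (Fin n × Fin n)) (hP : P.IsFanInTwo)
    (hc : P.Computes (ladder n M)) :
    (2 : ℝ) ^ ((n + 2) / 3) * (1 + M) ≤
      4 * P.size * (n + 1) ^ 2 * ((1 + M) + 2 ^ ((n + 2) / 3)) := by
  have hn' : 3 ≤ Fintype.card (Fin n) := by rwa [Fintype.card_fin]
  obtain ⟨L, hlen, hsum, hL⟩ :=
    ArithCircuit.exists_balanced_decomposition P hP hc (isFullyOrdered_ladder M) hn'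
  rw [Fintype.card_fin] at hlen hL
  have hQpos : (0 : ℝ) < 1 + (M : ℝ) := by positivity
  have hDpos : (0 : ℝ) < (2 : ℝ) ^ ((n + 2) / 3) := by positivity
  set Q : ℝ := 1 + (M : ℝ) with hQ
  set D : ℝ := (2 : ℝ) ^ ((n + 2) / 3) with hD
  have hD0 : D ≠ 0 := hDpos.ne'
  -- per-term bound
  set B : ℝ := (n ! : ℝ) * Q / D + n ! with hB
  have hterm : ∀ x ∈ (L.map fun t => t.2.1 * t.2.2).map mass, x ≤ B := by
    intro x hx
    rw [List.map_map, List.mem_map] at hx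
    obtain ⟨t, ht, rfl⟩ := hx
    obtain ⟨ha, hb, h1, h2, hle⟩ := hL t ht
    have hm := mass_term_le_sharp ha hb hle
    have hf := factorial_mul_factorial_mul_two_pow_le h1 h2
    show mass (t.2.1 * t.2.2) ≤ B
    calc mass (t.2.1 * t.2.2)
        ≤ (t.1.card ! * (n - t.1.card) ! : ℝ) * Q + n ! := hm
      _ ≤ (n ! : ℝ) / D * Q + n ! := by
          gcongr
          rw [le_div_iff₀ hDpos]; exact hf
      _ = B := by rw [hB]; ring
  -- sum up
  have hmass : mass (ladder n M) = ((L.map fun t => t.2.1 * t.2.2).map mass).sum := by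
    rw [← hsum, mass_list_sum]
  have hsumle : mass (ladder n M) ≤ (L.length : ℝ) * B := by
    rw [hmass]
    have := List.sum_le_card_nsmul _ B hterm
    rw [List.length_map, List.length_map, nsmul_eq_mul] at this
    exact this
  have hT : (L.length : ℝ) ≤ 4 * P.size * (n + 1) ^ 2 := by exact_mod_cast hlen
  have hlow := mass_ladder_ge (n := n) M
  have hfac : (0 : ℝ) < n ! := by exact_mod_cast Nat.factorial_pos n
  have h1 : Q ≤ L.length * (Q / D + 1) := by
    have := hlow.trans hsumle
    rw [hB] at this
    have h' : (n ! : ℝ) * Q ≤ n ! * (L.length * (Q / D + 1)) := by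
      calc (n ! : ℝ) * Q ≤ L.length * ((n ! : ℝ) * Q / D + n !) := this
        _ = n ! * (L.length * (Q / D + 1)) := by ring
    exact le_of_mul_le_mul_left h' hfac
  have h3 : D * Q ≤ L.length * (Q + D) := by
    have := mul_le_mul_of_nonneg_left h1 hDpos.le
    have e : D * (L.length * (Q / D + 1)) = L.length * (Q + D) := by
      field_simp
    calc D * Q ≤ D * (L.length * (Q / D + 1)) := this
      _ = L.length * (Q + D) := e
  calc D * Q ≤ L.length * (Q + D) := h3
    _ ≤ 4 * P.size * (n + 1) ^ 2 * (Q + D) :=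
        mul_le_mul_of_nonneg_right hT (by positivity)

/-- Corollary: `min(2^{⌈n/3⌉}, 1+M) ≤ 8 s (n+1)²`. -/
theorem min_le_size_sharp (hn : 3 ≤ n) (M : ℝ≥0)
    (P : ArithCircuit ℝ≥0 (Fin n × Fin n)) (hP : P.IsFanInTwo)
    (hc : P.Computes (ladder n M)) :
    min ((2 : ℝ) ^ ((n + 2) / 3)) (1 + M) ≤ 8 * P.size * (n + 1) ^ 2 := by
  have h := monotone_size_lower_bound_sharp hn M P hP hc
  have hD : (0 : ℝ) < (2 : ℝ) ^ ((n + 2) / 3) := by positivity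
  have hQ : (0 : ℝ) < 1 + (M : ℝ) := by positivity
  have hT0 : (0 : ℝ) ≤ 4 * P.size * (n + 1) ^ 2 := by positivity
  set D : ℝ := (2 : ℝ) ^ ((n + 2) / 3)
  set Q : ℝ := 1 + (M : ℝ)
  set T : ℝ := 4 * P.size * (n + 1) ^ 2
  have hmin : min D Q * (Q + D) ≤ 2 * (D * Q) := by
    rcases le_total D Q with hDQ | hQD
    · rw [min_eq_left hDQ]; nlinarith
    · rw [min_eq_right hQD]; nlinarith
  have h' : min D Q * (Q + D) ≤ 2 * T * (Q + D) := by nlinarith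
  have hQD : 0 < Q + D := by positivity
  have := le_of_mul_le_mul_right h' hQD
  linarith

end PlusLadder

/-- **The `+`-ladder rung, sharp form (solo-blind).**  For `n ≥ 3` and every `M ≥ 0`, a monotone
fan-in-two arithmetic circuit over `ℝ≥0` computing `∏_i ∑_j x_{ij} + M · per_n` has size at least
`min(2^{⌈n/3⌉}, 1 + M) / (8 (n+1)²)`; in particular at least `M / (8(n+1)²)` for `M ≤ 2^{n/3}`.
Coefficient-valuation arguments cannot certify more than `1 + M` products
(`F + M per ≤ (1+M) F` and `F` is one product). -/
theorem soloBlind_plusLadder_sharp {n : ℕ} (hn : 3 ≤ n) (M : ℝ≥0)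
    (P : ArithCircuit ℝ≥0 (Fin n × Fin n)) (hP : P.IsFanInTwo)
    (hc : P.Computes ((∏ i : Fin n, ∑ j : Fin n, X (i, j)) +
      C M * ∑ σ : Equiv.Perm (Fin n), ∏ i, X (i, σ i))) :
    min ((2 : ℝ) ^ ((n + 2) / 3)) (1 + M) ≤ 8 * P.size * (n + 1) ^ 2 := by
  rw [← PlusLadder.fullSML_eq_prod_sum, ← PlusLadder.perNN_eq_sum_prod] at hc
  exact PlusLadder.min_le_size_sharp hn M P hP hc

end Summit.ValiantsHypothesis.ValiantsHypothesis.Theorems
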